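import Mathlib
import Literature.NumberTheory.LFunctions.Zhang2022.TypedSection15C
import HarnessLib

/-!
# Zhang (2022) §15.u055 — the RELATIVE reading of record candidate `Step15_u055Rel` (statement only)

Topic `Literature/NumberTheory/LFunctions/Zhang2022` (Landau–Siegel audit tree; verdict-neutral).
Y. Zhang, *Discrete mean estimates and the Landau–Siegel zero*, arXiv:2211.02515v1 (2022)
[Zhang2022LandauSiegel] — **an unrefereed manuscript under adjudication; the `def … : Prop` below is a
CLAIM-VARIANT (a reading of a sentence of the manuscript), STATED NOT ASSERTED; nothing here asserts
or denies Theorems 1–2.** Lane ZHANG-L, WP15 typer file, RE-TYPE candidate for the v19/v20 leaf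
`h15u055R : ∀ c′ ≥ c₁, Typed.Section15C.Step15_u055R c′ Typed.Section15C.inputs15AB` (§15 p. 87–88,
tex L4359–L4361: "By Lemma 15.3, we can move the contour of integration in the same way as in the
proof of Lemma 8.4 to obtain `Σ_{n<T} χ(n)τ₂(n)ϖ₁ⱼ(n)/n = L′(1,χ)²𝒰(1) + O(α₁)`").

WHY A RELATIVE READING (typing note with numbers; two independent reading checks, zl-w15-typer
WP15-TYPED-INVENTORY §6 and zl-libC-p4 INBOX 22:32Z): the residue at the triple pole `s = 0` of
`ζ(1+s)²L(1+s−βⱼ,χ)²U(1+s)Tˢω₁(s)/s` is `½H″(0)` with `H = (sζ(1+s))²L(1+s−βⱼ,χ)²U(1+s)Tˢω₁(s)`; with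
`L(1−βⱼ,χ) = −βⱼL′(1,χ) + O(α²𝓛³)`, `|βⱼ| ≍ c′jα`, `log T = 𝓛^{1.1}` the main term is
`L′(1,χ)²U(1)·(1 − 2βⱼ log T − 4γβⱼ − 2βⱼU′(1)/U(1)) + …`, i.e. the error is `≍ α𝓛^{1.1}` RELATIVE to
`L′(1,χ)²U(1)`; the typed ABSOLUTE `C·α𝓛` of `Step15_u055R` would need `L′(1,χ)²U(1) ≪ 𝓛^{−0.1}`, which
is nowhere in print (tree: `‖L′(1,χ)‖ ≤ 4e^{9/2}𝓛²`, `Lemma31.norm_deriv_LFunction_le_near_one`; under (A)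
`𝔞 ≫ 1`). The same relative pattern is the cell's record in §16/§17 (`Step16_u042R`, D-G-L4fam-1).
CONSUMER CHECK: the only consumer (u056 → (15.23)ᴿ → (15.24), `Ded1524.u056_rate1_of_partsRp`, rate
`O(1/𝓛)`) closes unchanged with the relative form, since `α𝓛^{1.1}·(1+|L′|)²·‖U(1)‖ ≤ C𝓛^{−7.9+4}`
(`Ded1524.u056_rate1_of_partsRel`, sibling theorems file `Section15U056RateRel`); the swap in the
skeleton is one-for-one (`h15u055R ↦ h15u055Rel`, chain term `u056_rate1_of_partsRp ↦ _partsRel`).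
No instances, no notation; nothing banked is restated.

## References
* Y. Zhang, arXiv:2211.02515v1 (2022), §15 pp. 87–88 (tex L4344–L4365), Lemma 15.3, §15.u054–u056;
  §8 Lemma 8.4 (the model contour shift). [cite: Zhang2022LandauSiegel, §15 p. 87]
-/

noncomputable section

open Complex Real ComplexConjugate
open Literature.NumberTheory.LFunctions.Zhang2022.Skeleton

namespace Literature.NumberTheory.LFunctions.Zhang2022.Typed.Section15C

variable (c' : ℝ) (X : Inputs15AB)

/-- **Relative reading of Z22:§15.u055 at the repaired object** (NOT PRINTED; RE-TYPE candidate for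
the v19/v20 leaf `h15u055R`, lane ZHANG-L WP15, rows G-L4t3-1 / D-G-L4fam-1 pattern): "`Σ_{n<T}
χ(n)τ₂(n)ϖ₁ⱼ(n)/n = L′(1,χ)²𝒰(1)·(1 + O(α log T))`", i.e.
`‖Σ_{n<T} − L′(1,χ)²U(1)‖ ≤ C·α𝓛^{1.1}·((1 + |L′(1,χ)|)²‖U(1)‖ + 1)` for the continuation `U` of the
repaired `𝒰₁ⱼ` (`IsCalU1R`), `1 ≤ j ≤ 3`. WHY (typing note, numbers): the residue at the triple pole
`s = 0` of `ζ(1+s)²L(1+s−βⱼ,χ)²U(1+s)Tˢω₁(s)/s` is `½H″(0)`, `H = (sζ(1+s))²L(1+s−βⱼ,χ)²U(1+s)Tˢω₁(s)`;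
besides `L′(1−βⱼ,χ)²U(1)` it contains `2L(1−βⱼ,χ)L′(1−βⱼ,χ)U(1)·log T ≍ 2c′jα𝓛^{1.1}·L′(1,χ)²U(1)`
(`L(1−βⱼ,χ) = −βⱼL′(1,χ) + O(α²𝓛³)`, `|βⱼ| ≍ c′jα`, `log T = 𝓛^{1.1}`), which the ABSOLUTE error
`C·α𝓛` of `Step15_u055R` cannot absorb unless `L′(1,χ)²U(1) ≪ 𝓛^{−0.1}` (no such bound in print; the
tree has only `‖L′(1,χ)‖ ≤ 4e^{9/2}𝓛²`, `Lemma31.norm_deriv_LFunction_le_near_one`). The additive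
`+1` covers the unsmoothing input u054 (`O(α₁)`, absolute) and the shifted integral. Weaker than
`Step15_u055R` (`step15_u055Rel_of_R`); sufficient for the consumer u056/(15.23)ᴿ at the rate `O(1/𝓛)`
(`Ded1524.u056_rate1_of_partsRel`). CLAIM-VARIANT, stated not asserted.
[cite: Zhang2022LandauSiegel, §15 p.87] -/
def Step15_u055Rel : Prop :=
  ∃ C : ℝ, ForAllLarge fun D _ χ => AssumptionA D χ → ∀ j ∈ ({1, 2, 3} : Finset ℕ),
    ∀ U : ℂ → ℂ, IsCalU1R c' X χ j U →
      ‖sumLtT c' X χ j - deriv χ.LFunction 1 ^ 2 * U 1‖ ≤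
        C * (alpha D * ell D ^ (1.1 : ℝ)) *
          ((1 + ‖deriv χ.LFunction 1‖) ^ 2 * ‖U 1‖ + 1)

/-- **§15.u055 at the repaired object — NODE OF RECORD for the re-typed leaf h15u055R (RULINGS
R-34 / R-34-clarification, RT-07 amended; the owner zl-w15-p2's text verbatim,
wp15/zl-w15-p2/RT07-PROVABILITY-CHECK.md §«Proposed amendment», countersigned by zl-w15-ref-2)**:
for the continuation `U` of the repaired `𝒰₁ⱼ` (`IsCalU1R`) and any `S` bounding `‖U s‖` on the disc
`‖s − 1‖ ≤ 1/𝓛` and, up to the factor `e^{2𝓛^{1/10}}` of RULING 15e, on the half-plane `Re s ≥ 9/10`: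
`‖Σ_{n<T} χ(n)τ₂(n)ϖ₁ⱼ(n)/n − L′(1,χ)²U(1)‖ ≤ C·α𝓛³·((1 + |L′(1,χ)|)²·S + 1)`. WHY (numbers; supersedes
`Step15_u055Rel`, which is NOT of record): the residue at the triple pole `s = 0` of
`ζ(1+s)²L(1+s−βⱼ,χ)²U(1+s)Tˢω₁(s)/s` is, to first order in `βⱼ` (`|βⱼ| ≍ α`),
`L′(1,χ)²U(1) − βⱼ·[2L′(1,χ)²U(1)·log T + 4γL′(1,χ)²U(1) + 2L′(1,χ)²U′(1) + 3L′(1,χ)L″(1,χ)U(1)] + …`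
(`log T = 𝓛^{1.1}`); ALL four first-order terms are budgeted here: `U′(1), U″(1)` through Cauchy on the
disc of radius `1/𝓛` (`|U′(1)| ≤ S𝓛`, `|U″(1)| ≤ 2S𝓛²`), `L″(1,χ) ≪ 𝓛³` unconditionally (Cauchy from the
tree's `DirichletLFunctionBounds.norm_LFunction_le_of_re_ge`), `|L′(1,χ)| ≤ 4e^{9/2}𝓛²`
(`Lemma31.norm_deriv_LFunction_le_near_one`); the shifted integral uses the half-plane hypothesis
(`T^{−1/10}·poly·S·e^{2𝓛^{1/10}}`); the `+1` absorbs the unsmoothing u054 (`O(α₁)`). vs PRINT (§15 p.87,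
tex L4359–4361: "`= L′(1,χ)²𝒰(1) + O(α₁)`", absolute): WEAKER — `α·𝓛³` × the relative factor
`(1+|L′(1,χ)|)²·sup_{|s−1|≤1/𝓛}|U| + 1`, plus the half-plane growth hypothesis of RULING 15e. CONSUMER:
`u056_rate1_of_partsRelS` (zl-libC-p4; error `|𝓜₁(1,1;1−βⱼ)|·C·α𝓛³·((1+4e^{9/2}𝓛²)²·C₇𝓛 + 1) ≤ C′/𝓛`
with the near-1 bound `S ≤ C₇𝓛` from the Euler product of `calU1R`). CLAIM-VARIANT, stated not asserted.
[cite: Zhang2022LandauSiegel, §15 p. 87] -/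
def Step15_u055RelS : Prop :=
  ∃ C : ℝ, ForAllLarge fun D _ χ => AssumptionA D χ → ∀ j ∈ ({1, 2, 3} : Finset ℕ),
    ∀ U : ℂ → ℂ, IsCalU1R c' X χ j U → ∀ S : ℝ,
      (∀ s : ℂ, ‖s - 1‖ ≤ 1 / ell D → ‖U s‖ ≤ S) →
      (∀ s : ℂ, 9 / 10 ≤ s.re → ‖U s‖ ≤ S * Real.exp (2 * ell D ^ (1 / 10 : ℝ))) →
        ‖sumLtT c' X χ j - deriv χ.LFunction 1 ^ 2 * U 1‖ ≤
          C * (alpha D * ell D ^ 3) * ((1 + ‖deriv χ.LFunction 1‖) ^ 2 * S + 1)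

end Literature.NumberTheory.LFunctions.Zhang2022.Typed.Section15C
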